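import Summits.QuantumFields.YangMills.Theorems.BalabanUVNodesN17TwoRunShiftFirstEntry
import Mathlib.Analysis.PSeries

/-!
# NODE N17 (NE4) — FILE 8: CRIT-2's MARGINAL-TRANSPORT TOY, WHICH ADMITS NO BOX LETTER AT ANY GEOMETRIC RATE (FILE 7), SATISFIES FILE 5's RUN-WINDOW LETTER WITH A SUMMABLE
# (`≍ 1∕k²`) MODULUS — so FILE 5's lever returns every run-wise constant remainder for it: a NON-FLAT inhabitant of the run-keyed lever, and the exact sense in which the F-E shadow
# kills the GEOMETRIC BOX keying of node N17's input but NOT the SUMMABLE RUN keying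

Cell `pub-ymgap`, YM-PLAN Track A (HUMAN RULINGS D-0062 ∕ D-0149), WIDTH SEAT `pub-ymgap-dag-n17-w1` (generation 6), CLAIM-3 ∕ INTENT-3.  Key K3⁸ stmt-QuantumFields-27366
`SpineGivenEndpointR13SepCoPHV` (`--kind proof --supports stmt-QuantumFields-27366 --as helper`, COUNT-NEUTRAL).  Continues FILE 5 (p608124 `…N17RunWindowShift`: the lever keyed on
SLIDING WINDOWS of in-window runs), FILE 6 (p627997) and FILE 7 (p630045 `…N17TwoRunShiftFirstEntry`: `not_scaleShiftRate_transportToy`).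

THE TOY (ym-nodeO CRIT-2 g3 E-CRIT2-2 ∕ idea-5 §11·N; a caricature, NOT Bałaban's β).  `β_k(g_0,…,g_k) := β₀ + α·g_0²∕(1 + c·k·g_0²)` — FIRST-ENTRY-ONLY by construction (H_FE′'s
shape), with print's one-loop constant `β₀ ≥ 0` plus an `α g²`-type term READ AT THE FREE-TRANSPORTED COUPLING `g_0²∕(1 + ckg_0²)` (the transport identification (T) with a free
transport rate `c > 0`, not tied to `β₀` — the caricature's one liberty).  In this file the toy is a HYPOTHESIS TEXT on `β` (`hβ : ∀ k p, β k p = β₀ + α (p 0)²∕(1 + c k (p 0)²)`), so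
every theorem is about ANY family equal to it.

WHAT THIS FILE PROVES (theorems only; 0 `def`, 0 `instance`, 0 `sorry`).
§1 `inv_sq_succ_of_toyRun` — along an in-window run of the toy's OWN recursion (0.20), `1∕g_{i+1}² = 1∕g_i² − (β₀ + α g_0²∕(1 + c i g_0²))`; `toyWindowShift_eq` — the run-window shift
   of FILE 5 at window `(j, k)` is EXACTLY `α·(δ + c)∕((u + c(k+1))·(u − δ + ck))` with `u := 1∕g_j²`, `δ := β₀ + α g_0²∕(1 + cjg_0²) ∈ [β₀, β₀ + αγ²]`; ★ `runWindowShift_toy` — under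
   the window condition `2γ²(β₀ + αγ²) ≤ 1` it is `≤ a_k := α(β₀ + αγ² + c)∕(c·m·(k+1)²)`, `m := min c (1∕(2γ²))`, for EVERY window of EVERY in-window run: FILE 5's run-window letter with
   a SUMMABLE, POLYNOMIAL modulus (`summable_toyModulus`); `scaleAnchor_toy` — the toy anchors at the constant numbers `b ≡ β₀` (radius `min 1 (δ∕α)`); ★★
   `exists_runConstRemainder_toy` — FILE 5's ★ `exists_runConstRemainder_of_runWindowShift_cornerStep_scaleAnchor` applied (corner step `0`): `∀ s > 0 ∃ γ_s ∈ ]0,γ]`,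
   `RunConstRemainder β (fun _ ↦ β₀) s γ_s` — a NON-FLAT, first-entry-only inhabitant of the run-keyed lever's binder set (A6, with teeth: FILE 6 §3's inhabitant was the flat family);
   `endRuns_toy` — the toy meets FILE 6's (ER) as well (continuous, `0 ≤ β ≤ β₀ + αγ²` on the boxes), so the run quantifier is not vacuous for it.
§2 `not_scaleShiftRate_toy` — the SAME family admits NO box letter `ScaleShiftRate c′ θ γ` with `0 ≤ θ < 1` (FILE 7's `not_scaleShiftRate_transportToy` BY NAME, transported along
   `hβ`).  TOGETHER: on the critics' own caricature of the record mod H_FE′ + (T), node N17's GEOMETRIC BOX keying is FALSE while its RUN-WINDOW keying holds SUMMABLY and FILE 5's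
   lever delivers DEF-1's `RunConstRemainder` at every height — the located design input «re-key N17 run-wise with a summable modulus» (R-N17-RUN) made checkable on a model.
ATTRIBUTION (located by ym-nodeO CRIT-2 g4, HOME STATUS S.2134; Cruxes∕ kernels are not importable from Theorems∕, so the names are CITED, not re-declared).  The family is idea-7's TOY F
`betaMT` (`Cruxes/EndpointGivenBR13SepCoPH/Idea7V7cCornerNecessity.lean` :1474, the case β₀ = α = c = 1; :1443 `geomRigid_of_firstEntryOnly_scaleShiftRate`, :1595
`not_scaleShiftRate_betaMT`), made parametric by CRIT-2 g3 (`…/Crit2ModulusPrefactorToy.lean` `modulusWithPrefactor_not_geom`) and CRIT-1 (`…/Crit1ShiftOscToy.lean` `shiftOsc_not_geom`);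
the transport FACTOR `1∕(1 + ckg_0²)` and its polynomial readings are idea-5 §11·N (`…/Idea5g13RunOnlyRoadSketch6.lean` :1488 `marginalTransport_not_geomFading`, :1522
`marginalTransport_le_inv`).  FILE 7 §1's `osc_le_of_firstEntryOnly_scaleShiftRate` ∕ `not_scaleShiftRate_transportToy` are the Theorems-lane parametric twins of idea-7's :1443 ∕ :1595.
NEW here: the RUN-WINDOW side (§1) — the toy's positive content in node N17's run keying.
HONEST SCOPE (A6).  A toy over a GENERIC `β : HBeta`; nothing of Bałaban asserted or instantiated; whether NODE 00's record is first-entry-only ∕ transport-read is node00-def ∕ def-T's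
desk (director-ym №210), not settled here; NE4 NOT IN PRINT ([Balaban1987RG1] p. 264) and NOT proved in any keying; NOT a proof of any K3⁸ ∕ K1⁹ stub; N17 NOT discharged
(DEPENDENT∕DERIVED row); K0⁷ ∕ K1⁹ ∕ K3⁸ OPEN; counts UNMOVED (typed 28∕28 · discharged 5∕27 · A 5∕28).  One finite four-torus programme at fixed `ε = L^{−K}`, Bałaban AS PRINTED; the YM
mass gap (Clay) is NOT proved by any of this — R4 closes the conditional finite-𝕋⁴ rung `BalabanLadder.UV` only; nothing continuum ∕ ℝ⁴ ∕ OS.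
[I] = [Balaban1987RG1] T. Bałaban, CMP **109** (1987): (0.20) p. 256, Thm 3 p. 264, (1.20)–(1.22) p. 264, (2.12)–(2.14) p. 268.
-/

noncomputable section

namespace Summit.QuantumFields.YangMills.BalabanUVNodes.N17RunWindowShiftTransportToy

open Literature.MathematicalPhysics.QuantumFieldTheory.Balaban1983to89
open Literature.MathematicalPhysics.QuantumFieldTheory.Balaban1983to89.FlowStep
open Literature.MathematicalPhysics.QuantumFieldTheory.Balaban1983to89.T4CouplingMatching (ScaleShiftRate)
open Literature.MathematicalPhysics.QuantumFieldTheory.Balaban1983to89.B12Beta (HistBox)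
open Summit.QuantumFields.YangMills.Theorems.BalabanUVNodesK2NamedJetsRemAt (ScaleAnchor)
open Summit.QuantumFields.YangMills.Theorems.BalabanUVNodesK2NamedJetsRunRemAt (RunConstRemainder)
open Summit.QuantumFields.YangMills.BalabanUVNodes.N17RunWindowShift (exists_runConstRemainder_of_runWindowShift_cornerStep_scaleAnchor)
open Summit.QuantumFields.YangMills.BalabanUVNodes.N17TwoRunShiftFirstEntry (not_scaleShiftRate_transportToy)
open Finset

variable {β : HBeta} {β₀ α c γ : ℝ}

/-! ## §1 The toy's own runs: the run-window letter with a summable polynomial modulus, the anchor, every run-wise constant remainder -/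

/-- THE TOY's RECURSION ALONG ITS OWN RUNS: for an in-window solution `gs` of (0.20) with the toy family, `1∕g_{i+1}² = 1∕g_i² − (β₀ + α g_0²∕(1 + c·i·g_0²))` — first-entry-only: every
step reads the run's BARE coupling `g_0`. [cite: Balaban1987RG1, (0.20) p.256] -/
theorem inv_sq_succ_of_toyRun (hβ : ∀ (k : ℕ) (p : Fin (k + 1) → ℝ), β k p = β₀ + α * (p 0) ^ 2 / (1 + c * k * (p 0) ^ 2))
    {n : ℕ} {gs : ℕ → ℝ} (hrg : RGEqH n β gs) {i : ℕ} (hi : i < n) :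
    1 / gs (i + 1) ^ 2 = 1 / gs i ^ 2 - (β₀ + α * (gs 0) ^ 2 / (1 + c * i * (gs 0) ^ 2)) := by
  have h := hrg i hi
  rw [hβ i] at h
  simp only [prefixOf_apply, Fin.val_zero] at h
  linarith

/-- **THE RUN-WINDOW SHIFT OF THE TOY, EXACTLY**: at the window `(g_j, …, g_{j+k+1})` of an in-window run of the toy, FILE 5's shift `β_{k+1}(g_j,…) − β_k(g_{j+1},…)` equals
`−α(δ + c)∕((u + c(k+1))(u − δ + ck))` with `u := 1∕g_j²` and `δ := β₀ + α g_0²∕(1 + cjg_0²)` (the toy's step at scale `j`, so `1∕g_{j+1}² = u − δ`), provided `u − δ + ck > 0`. [folklore] -/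
theorem toyWindowShift_eq (hβ : ∀ (k : ℕ) (p : Fin (k + 1) → ℝ), β k p = β₀ + α * (p 0) ^ 2 / (1 + c * k * (p 0) ^ 2)) (hc : 0 ≤ c)
    {n : ℕ} {gs : ℕ → ℝ} (hrg : RGEqH n β gs) (hI : Step.InInterval γ n gs) {j k : ℕ} (hjk : j + (k + 1) ≤ n)
    (hpos : 0 < 1 / gs j ^ 2 - (β₀ + α * (gs 0) ^ 2 / (1 + c * j * (gs 0) ^ 2)) + c * k) :
    β (k + 1) (prefixOf (fun i => gs (j + i)) (k + 1)) - β k (prefixOf (fun i => gs (j + 1 + i)) k)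
      = -(α * ((β₀ + α * (gs 0) ^ 2 / (1 + c * j * (gs 0) ^ 2)) + c) /
          ((1 / gs j ^ 2 + c * (k + 1)) * (1 / gs j ^ 2 - (β₀ + α * (gs 0) ^ 2 / (1 + c * j * (gs 0) ^ 2)) + c * k))) := by
  have hx : 0 < gs j := (hI j (by omega)).1
  have hy : 0 < gs (j + 1) := (hI (j + 1) (by omega)).1
  have hstep := inv_sq_succ_of_toyRun hβ hrg (i := j) (by omega)
  rw [hβ (k + 1), hβ k]
  simp only [prefixOf_apply, Fin.val_zero, Nat.add_zero, Nat.cast_succ]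
  set u : ℝ := 1 / gs j ^ 2 with hu_def
  set δ : ℝ := β₀ + α * (gs 0) ^ 2 / (1 + c * j * (gs 0) ^ 2) with hδ_def
  have hu : 0 < u := by positivity
  have hyinv : 0 < 1 / gs (j + 1) ^ 2 := by positivity
  have huδ : 0 < u - δ := by rw [← hstep]; exact hyinv
  have hxsq : gs j ^ 2 = 1 / u := by rw [hu_def, one_div_one_div]
  have hysq : gs (j + 1) ^ 2 = 1 / (u - δ) := by rw [← hstep, one_div_one_div]
  have h1 : 0 < u + c * (k + 1) := by positivity
  have hune : u ≠ 0 := hu.ne'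
  have huδne : u - δ ≠ 0 := huδ.ne'
  have h1ne : u + c * (k + 1) ≠ 0 := h1.ne'
  have h2ne : u - δ + c * k ≠ 0 := hpos.ne'
  rw [hxsq, hysq]
  have hA : 1 + c * ((k : ℝ) + 1) * (1 / u) = (u + c * (k + 1)) / u := by field_simp
  have hB : 1 + c * (k : ℝ) * (1 / (u - δ)) = (u - δ + c * k) / (u - δ) := by field_simp
  rw [hA, hB]
  field_simp
  ring

/-- **★ THE TOY SATISFIES FILE 5's RUN-WINDOW LETTER WITH A SUMMABLE POLYNOMIAL MODULUS**: with `α > 0`, `c > 0`, `β₀ ≥ 0`, `γ > 0` and the window condition `2γ²(β₀ + αγ²) ≤ 1`, for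
EVERY in-window run of the toy's own recursion and EVERY window `(j, k)`:
`|β_{k+1}(g_j,…,g_{j+k+1}) − β_k(g_{j+1},…,g_{j+k+1})| ≤ α(β₀ + αγ² + c)∕(c·m·(k+1)²)`, `m := min c (1∕(2γ²))` — from `toyWindowShift_eq` with `u + c(k+1) ≥ c(k+1)` and
`u − δ + ck ≥ 1∕(2γ²) + ck ≥ m(k+1)` (`u ≥ 1∕γ²`, `δ ≤ β₀ + αγ² ≤ 1∕(2γ²)`).  Compare FILE 7: the same family has NO box letter at any geometric rate. [cite: Balaban1987RG1, (0.20) p.256 and (1.20)-(1.22) p.264] -/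
theorem runWindowShift_toy (hβ : ∀ (k : ℕ) (p : Fin (k + 1) → ℝ), β k p = β₀ + α * (p 0) ^ 2 / (1 + c * k * (p 0) ^ 2))
    (hα : 0 < α) (hc : 0 < c) (hβ₀ : 0 ≤ β₀) (hγ : 0 < γ) (hwin : 2 * γ ^ 2 * (β₀ + α * γ ^ 2) ≤ 1) :
    ∀ (n : ℕ) (gs : ℕ → ℝ), RGEqH n β gs → Step.InInterval γ n gs → ∀ j k : ℕ, j + (k + 1) ≤ n →
      |β (k + 1) (prefixOf (fun i => gs (j + i)) (k + 1)) - β k (prefixOf (fun i => gs (j + 1 + i)) k)|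
        ≤ α * (β₀ + α * γ ^ 2 + c) / (c * min c (1 / (2 * γ ^ 2)) * ((k : ℝ) + 1) ^ 2) := by
  intro n gs hrg hI j k hjk
  have hx := hI j (by omega)
  have h0 := hI 0 (Nat.zero_le _)
  set u : ℝ := 1 / gs j ^ 2 with hu_def
  set δ : ℝ := β₀ + α * (gs 0) ^ 2 / (1 + c * j * (gs 0) ^ 2) with hδ_def
  set m : ℝ := min c (1 / (2 * γ ^ 2)) with hm_def
  have hm : 0 < m := lt_min hc (by positivity)
  have hmc : m ≤ c := min_le_left _ _
  have hmγ : m ≤ 1 / (2 * γ ^ 2) := min_le_right _ _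
  -- δ ∈ [0, β₀ + αγ²]
  have hfrac : α * (gs 0) ^ 2 / (1 + c * j * (gs 0) ^ 2) ≤ α * γ ^ 2 := by
    have hnn : 0 ≤ c * j * (gs 0) ^ 2 := by positivity
    have hden : 1 ≤ 1 + c * j * (gs 0) ^ 2 := by linarith
    have h1 : α * (gs 0) ^ 2 / (1 + c * j * (gs 0) ^ 2) ≤ α * (gs 0) ^ 2 := div_le_self (by positivity) hden
    have h2 : (gs 0) ^ 2 ≤ γ ^ 2 := by nlinarith [h0.1, h0.2]
    nlinarith
  have hδ0 : 0 ≤ δ := by rw [hδ_def]; positivity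
  have hδle : δ ≤ β₀ + α * γ ^ 2 := by rw [hδ_def]; linarith
  -- u ≥ 1/γ²
  have huγ : 1 / γ ^ 2 ≤ u := by
    rw [hu_def]
    exact one_div_le_one_div_of_le (by nlinarith [hx.1]) (by nlinarith [hx.1, hx.2])
  have hγ2 : 0 < 2 * γ ^ 2 := by positivity
  have hδγ : δ ≤ 1 / (2 * γ ^ 2) := by
    rw [le_div_iff₀ hγ2]
    nlinarith
  have h12 : 1 / (2 * γ ^ 2) + 1 / (2 * γ ^ 2) = 1 / γ ^ 2 := by
    field_simp
    ring
  have hk0 : (0 : ℝ) ≤ k := Nat.cast_nonneg k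
  -- the two denominators
  have hD1 : c * ((k : ℝ) + 1) ≤ u + c * (k + 1) := by linarith [lt_of_lt_of_le (by positivity : (0:ℝ) < 1 / γ ^ 2) huγ]
  have hD2 : m * ((k : ℝ) + 1) ≤ u - δ + c * k := by
    have : m * (k : ℝ) ≤ c * k := mul_le_mul_of_nonneg_right hmc hk0
    nlinarith
  have hD2pos : 0 < u - δ + c * k := lt_of_lt_of_le (by positivity) hD2
  have hD1pos : 0 < u + c * (k + 1) := lt_of_lt_of_le (by positivity) hD1
  have heq := toyWindowShift_eq hβ hc.le hrg hI hjk hD2pos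
  rw [heq, abs_neg, abs_of_nonneg (by positivity)]
  -- α(δ + c)/(D1 D2) ≤ α(δmax + c)/(c m (k+1)²)
  have hprod : c * m * ((k : ℝ) + 1) ^ 2 ≤ (u + c * (k + 1)) * (u - δ + c * k) := by
    have := mul_le_mul hD1 hD2 (by positivity) hD1pos.le
    nlinarith
  calc α * (δ + c) / ((u + c * (k + 1)) * (u - δ + c * k))
      ≤ α * (β₀ + α * γ ^ 2 + c) / ((u + c * (k + 1)) * (u - δ + c * k)) :=
        div_le_div_of_nonneg_right (by nlinarith) (by positivity)
    _ ≤ α * (β₀ + α * γ ^ 2 + c) / (c * m * ((k : ℝ) + 1) ^ 2) :=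
        div_le_div_of_nonneg_left (by positivity) (by positivity) hprod

/-- The modulus `k ↦ K∕(D·(k+1)²)` is summable (`p`-series, `p = 2`, shifted by one). [folklore] -/
theorem summable_toyModulus (K D : ℝ) : Summable fun k : ℕ => K / (D * ((k : ℝ) + 1) ^ 2) := by
  have h : Summable fun k : ℕ => 1 / (((k + 1 : ℕ) : ℝ)) ^ 2 :=
    (summable_nat_add_iff 1).mpr (Real.summable_one_div_nat_pow.mpr one_lt_two)
  have h' : Summable fun k : ℕ => 1 / (((k : ℝ) + 1) ^ 2) := by
    convert h using 2 with k
    push_cast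
    ring
  refine (h'.mul_left (K / D)).congr fun k => ?_
  show K / D * (1 / (((k : ℝ) + 1) ^ 2)) = K / (D * ((k : ℝ) + 1) ^ 2)
  rw [div_mul_eq_div_div, mul_one_div]

/-- **THE TOY ANCHORS AT THE CONSTANT NUMBERS `b ≡ β₀`** (DEF-1's `ScaleAnchor`): `|β_k(p) − β₀| = α(p 0)²∕(1 + ck(p 0)²) ≤ α·(p 0)² ≤ δ` once `p 0 ≤ min 1 (δ∕α)`. [folklore] -/
theorem scaleAnchor_toy (hβ : ∀ (k : ℕ) (p : Fin (k + 1) → ℝ), β k p = β₀ + α * (p 0) ^ 2 / (1 + c * k * (p 0) ^ 2)) (hα : 0 < α) (hc : 0 ≤ c) :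
    ScaleAnchor β (fun _ => β₀) := by
  intro k δ hδ
  refine ⟨min 1 (δ / α), lt_min one_pos (div_pos hδ hα), fun p hp => ?_⟩
  have hp0 := hp 0
  have hx0 : 0 < p 0 := hp0.1
  have hx1 : p 0 ≤ 1 := hp0.2.trans (min_le_left _ _)
  have hxδ : p 0 ≤ δ / α := hp0.2.trans (min_le_right _ _)
  have hnn : 0 ≤ c * k * (p 0) ^ 2 := by positivity
  have hden : 1 ≤ 1 + c * k * (p 0) ^ 2 := by linarith
  have hfrac : α * (p 0) ^ 2 / (1 + c * k * (p 0) ^ 2) ≤ α * (p 0) ^ 2 := div_le_self (by positivity) hden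
  have hfrac0 : 0 ≤ α * (p 0) ^ 2 / (1 + c * k * (p 0) ^ 2) := by positivity
  have hsq : α * (p 0) ^ 2 ≤ α * p 0 := by nlinarith
  have hxδ' : α * p 0 ≤ δ := by
    have := mul_le_mul_of_nonneg_left hxδ hα.le
    rwa [mul_div_cancel₀ _ hα.ne'] at this
  have e₁ : β k p - β₀ = α * (p 0) ^ 2 / (1 + c * k * (p 0) ^ 2) := by rw [hβ k]; ring
  rw [e₁, abs_of_nonneg hfrac0]
  linarith

/-- ★★ **EVERY RUN-WISE CONSTANT REMAINDER FOR THE TOY, FROM FILE 5's RUN-KEYED LEVER** (`exists_runConstRemainder_of_runWindowShift_cornerStep_scaleAnchor` BY NAME: anchor `scaleAnchor_toy`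
+ the summable run-window modulus `runWindowShift_toy` ∕ `summable_toyModulus` + corner step `0` of the constant numbers): `∀ s > 0 ∃ γ_s ∈ ]0,γ]`, `RunConstRemainder β (fun _ ↦ β₀) s γ_s`.
A NON-FLAT, FIRST-ENTRY-ONLY inhabitant of the lever's binder set — the family FILE 7 shows to have NO box letter at any geometric rate.  A toy; nothing of Bałaban.
[cite: Balaban1987RG1, Thm 3 p.264 and (2.12)-(2.14) p.268] -/
theorem exists_runConstRemainder_toy (hβ : ∀ (k : ℕ) (p : Fin (k + 1) → ℝ), β k p = β₀ + α * (p 0) ^ 2 / (1 + c * k * (p 0) ^ 2))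
    (hα : 0 < α) (hc : 0 < c) (hβ₀ : 0 ≤ β₀) (hγ : 0 < γ) (hwin : 2 * γ ^ 2 * (β₀ + α * γ ^ 2) ≤ 1) {s : ℝ} (hs : 0 < s) :
    ∃ γs : ℝ, 0 < γs ∧ γs ≤ γ ∧ RunConstRemainder β (fun _ => β₀) s γs :=
  exists_runConstRemainder_of_runWindowShift_cornerStep_scaleAnchor
    (a := fun k => α * (β₀ + α * γ ^ 2 + c) / (c * min c (1 / (2 * γ ^ 2)) * ((k : ℝ) + 1) ^ 2)) (e := fun _ => 0)
    hγ (scaleAnchor_toy hβ hα hc.le) (runWindowShift_toy hβ hα hc hβ₀ hγ hwin) (summable_toyModulus _ _)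
    (fun _ => by simp) summable_zero hs

/-- **THE TOY MEETS (ER) TOO** (FILE 6's end-runs side letter, via `endRuns_of_betaSign_cont_upper`): it is continuous on every box, `≥ 0` (as `β₀ ≥ 0`, `α > 0`) and `≤ β₀ + αγ²`
there; so at every level `γ′ ≤ γ` every endpoint `g ∈ ]0,γ′]` is reached by an in-window run of every length — in particular the run quantifier of `RunConstRemainder` above is NOT
vacuous for the toy.  (Its IR-matched two-run shift (TR) is not computed here: the toy's tuned pairs are implicit.) [folklore] -/
theorem endRuns_toy (hβ : ∀ (k : ℕ) (p : Fin (k + 1) → ℝ), β k p = β₀ + α * (p 0) ^ 2 / (1 + c * k * (p 0) ^ 2))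
    (hα : 0 < α) (hc : 0 ≤ c) (hβ₀ : 0 ≤ β₀) :
    ∀ γ' : ℝ, 0 < γ' → γ' ≤ γ → ∀ (k : ℕ) (g : ℝ), 0 < g → g ≤ γ' →
      ∃ hs : ℕ → ℝ, RGEqH k β hs ∧ Step.InInterval γ' k hs ∧ hs k = g := by
  have e : β = fun (k : ℕ) (p : Fin (k + 1) → ℝ) => β₀ + α * (p 0) ^ 2 / (1 + c * (k : ℝ) * (p 0) ^ 2) :=
    funext fun k => funext fun p => hβ k p
  have hden : ∀ (k : ℕ) (x : ℝ), 1 ≤ 1 + c * k * x ^ 2 := fun k x => by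
    have : 0 ≤ c * k * x ^ 2 := by positivity
    linarith
  have hcont : BetaContH γ β := by
    intro k
    rw [e]
    refine Continuous.continuousOn ?_
    have h0 : Continuous fun p : Fin (k + 1) → ℝ => p 0 := continuous_apply 0
    exact continuous_const.add ((continuous_const.mul (h0.pow 2)).div
      (continuous_const.add ((continuous_const.mul (h0.pow 2)))) fun p => by nlinarith [hden k (p 0)])
  have hsign : BetaLowerH 0 γ β := fun k v _ => by
    rw [hβ k]
    have := hden k (v 0)
    positivity
  have hhi : BetaUpperH (β₀ + α * γ ^ 2) γ β := fun k v hv => by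
    rw [hβ k]
    have hv0 := (mem_box.mp hv) 0
    have h1 : α * (v 0) ^ 2 / (1 + c * k * (v 0) ^ 2) ≤ α * (v 0) ^ 2 := div_le_self (by positivity) (hden k (v 0))
    have h2 : (v 0) ^ 2 ≤ γ ^ 2 := by nlinarith [hv0.1, hv0.2]
    nlinarith
  exact N17TwoRunShift.endRuns_of_betaSign_cont_upper (by positivity) hcont hsign hhi

/-! ## §2 … while the same family has NO box letter at any geometric rate (FILE 7 BY NAME) -/

/-- **NO BOX LETTER FOR THE TOY** (FILE 7's `not_scaleShiftRate_transportToy`, transported along `hβ`; = the parametric form of idea-7 TOY F's `not_scaleShiftRate_betaMT`,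
`Cruxes/EndpointGivenBR13SepCoPH/Idea7V7cCornerNecessity.lean` :1595, cited — Cruxes∕ is not importable here): `¬ ∃ c′ θ, 0 ≤ θ < 1 ∧ ScaleShiftRate c′ θ γ β`.  With §1: on the critics' caricature
of the record mod H_FE′ + (T), node N17's GEOMETRIC BOX keying fails while its SUMMABLE RUN-WINDOW keying holds and FILE 5's lever delivers every run-wise constant remainder. [folklore] -/
theorem not_scaleShiftRate_toy (hβ : ∀ (k : ℕ) (p : Fin (k + 1) → ℝ), β k p = β₀ + α * (p 0) ^ 2 / (1 + c * k * (p 0) ^ 2))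
    (hα : 0 < α) (hc : 0 ≤ c) (hγ : 0 < γ) : ¬ ∃ c' θ : ℝ, 0 ≤ θ ∧ θ < 1 ∧ ScaleShiftRate c' θ γ β := by
  have e : β = fun (k : ℕ) (p : Fin (k + 1) → ℝ) => β₀ + α * (p 0) ^ 2 / (1 + c * (k : ℝ) * (p 0) ^ 2) :=
    funext fun k => funext fun p => hβ k p
  rw [e]
  exact not_scaleShiftRate_transportToy hα hc hγ

end Summit.QuantumFields.YangMills.BalabanUVNodes.N17RunWindowShiftTransportToy

end
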